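import Summits.AnomalousDissipation.AnomalousDissipation.Theorems.SolenoidalFractalHomogenisationLagrangianStepSidebandXGenFrame
import Summits.AnomalousDissipation.AnomalousDissipation.Theorems.SolenoidalFractalHomogenisationLagrangianStepSidebandXDefectAlgebra
import Summits.AnomalousDissipation.AnomalousDissipation.Theorems.SolenoidalFractalHomogenisationLagrangianStepTransverseSymbolLipschitzFrame
import HarnessLib

/-!
# K1L_D `LagrangianRenormalisationStepDesign` (stmt-AnomalousDissipation-27980), registered stub `stub_D1_V0thg` (v28, ruling D28-3 (3)), port-map layer L5:
# ALGEBRA OF THE FROZEN-FRAME DEFECT — homogeneity of the twisted covector, scale invariance of the twisted projection, the twisted projection of a nearby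
# direction, and the twisted VISCOUS ξ-DEFECT PAIRING BOUND (helper; `--supports stmt-AnomalousDissipation-27980 --as helper`)

Summits-side helper file of route `SolenoidalFractalHomogenisation` (prover seat `ad-k1l-cellLawV-w1` g9; port map
`Cruxes/LagrangianRenormalisationStepDesign/Lines/onelevel-vtheta-twist-portmap.md` §3 L5, ruling D28-7).  The frozen-frame twin of `…SidebandXDefectAlgebra`
§2–§4 (§1 `linkCoeff_classFreq_eq_add` and the integer bookkeeping `classFreq_zero_left`, `classFreq_sub_classFreq_zero`, `freqNormSq_classFreq_zero` are flat,
REUSED BY NAME).  All bounds are stated with the TWISTED covector norms `nsqR (twistFreq G₀ ·)` (`= |G₀ᵀ·|²`); the consumers turn them into flat norms with the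
frame window `(1 − 3θ)²|k|² ≤ |G₀ᵀk|² ≤ (1 + 3θ)²|k|²` (`sq_one_sub_mul_freqNormSq_le_sum_twistFreq_sq`, `sum_twistFreq_sq_le_sq_one_add_mul_freqNormSq`).
Everything proved; no definitions, no named facts, no sorry.
* `twistFreq_classFreq_zero`, `nsqR_twistFreq_eq_sum`, `nsqR_twistFreq_classFreq_zero`, `transversalProjR_real_smul`, `transversalProjR_twistFreq_classFreq_zero` —
  `G₀ᵀ(n·z) = n·G₀ᵀz`, `|G₀ᵀ(n z)|² = n²|G₀ᵀz|²`, `P_{c q} = P_q` (`c ≠ 0`), `P^θ_{n·z} = P^θ_z`;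
* `norm_waveVecRC`, `waveVecRC_sub`, `norm_transversalProjR_waveVecRC_le`, `norm_rdot_le`, **`norm_transversalProjR_sub_projR_le`** —
  `‖P_q (v − P_{q₀} v)‖ ≤ (√|q − q₀|²/√|q₀|²)·‖v‖` for real covectors (`|q₀|² > 0`);
* **`abs_re_visc_defect_le_frame`** — for `|G₀ᵀz|² > 0`, `n ≥ 1`, `4|G₀ᵀℓ|² ≤ n²|G₀ᵀz|²`, ALL `r, y ∈ ℂ³`, `K₀` any transverse bound of `β_𝔸`:
  `|Re⟪P^θ_{k_z} r, T_{((1/n²)•𝔸)^{G₀}}(k_z) P^θ_{k_z} y⟫ − Re⟪P^θ_z r, T_{𝔸^{G₀}}(z) P^θ_z y⟫| ≤ 534·K₀·√|G₀ᵀz|²·(√|G₀ᵀℓ|²/n)·‖y‖·‖r‖` (`k_z = ℓ + n·z`).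
At `G₀ = 1` these are the flat statements.
NOT a proof of any registered stub, of the crux, or of anomalous dissipation; rung F-D1 infrastructure for the `stub_D1_V0thg` engine.
-/

set_option linter.dupNamespace false

noncomputable section

namespace Summit.AnomalousDissipation.AnomalousDissipation.Theorems.SolenoidalFractalHomogenisation.LagrangianStep.Sideband

open Set MeasureTheory Complex UnitAddTorus
open scoped InnerProductSpace
open Literature.Analysis Literature.Analysis.FunctionSpaces Literature.Analysis.FunctionSpaces.Torus
open Literature.Analysis.FluidPDE Literature.Analysis.FluidPDE.Torus Literature.Analysis.FluidPDE.LatticeShear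
open Summit.AnomalousDissipation.AnomalousDissipation.Theorems.SolenoidalFractalHomogenisation.LagrangianStep.SymbolLipschitz (nsqR)

variable {k₀ : ℕ}

/-! ## §1 The class base point `n·z` in the frozen frame -/

/-- `G₀ᵀ(n·z) = n • G₀ᵀz`. [cite: MajdaKramer1999, §2.2.1.3] -/
theorem twistFreq_classFreq_zero (G₀ : Matrix (Fin 3) (Fin 3) ℝ) (n : ℕ) (z : Fin 3 → ℤ) :
    twistFreq G₀ (classFreq n 0 z) = (n : ℝ) • twistFreq G₀ z := by
  funext b
  simp only [twistFreq_apply, classFreq_zero_left, Pi.smul_apply, smul_eq_mul, Finset.mul_sum, Int.cast_mul, Int.cast_natCast]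
  exact Finset.sum_congr rfl fun a _ => by ring

/-- `nsqR q = Σ_a q_a²` (unfolding). [folklore] -/
theorem nsqR_eq_sum (q : Fin 3 → ℝ) : nsqR q = ∑ a, q a ^ 2 := rfl

/-- `|G₀ᵀ(n·z)|² = n²·|G₀ᵀz|²`. [cite: MajdaKramer1999, §2.2.1.3] -/
theorem nsqR_twistFreq_classFreq_zero (G₀ : Matrix (Fin 3) (Fin 3) ℝ) (n : ℕ) (z : Fin 3 → ℤ) :
    nsqR (twistFreq G₀ (classFreq n 0 z)) = (n : ℝ) ^ 2 * nsqR (twistFreq G₀ z) := by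
  rw [twistFreq_classFreq_zero, nsqR_eq_sum, nsqR_eq_sum, Finset.mul_sum]
  exact Finset.sum_congr rfl fun a _ => by rw [Pi.smul_apply, smul_eq_mul]; ring

/-- **Scale invariance of the real-covector projection**: `P_{c q} = P_q` for `c ≠ 0`. [cite: Temam1984, Ch. III §1.1] -/
theorem transversalProjR_real_smul {c : ℝ} (hc : c ≠ 0) (q : Fin 3 → ℝ) (v : EuclideanSpace ℂ (Fin 3)) :
    transversalProjR (c • q) v = transversalProjR q v := by
  by_cases hq : q = 0
  · subst hq; simp
  have hS : 0 < ∑ j, q j ^ 2 := by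
    obtain ⟨i, hi⟩ : ∃ i, q i ≠ 0 := by
      by_contra h; push Not at h; exact hq (funext h)
    exact lt_of_lt_of_le (by positivity : 0 < q i ^ 2) (Finset.single_le_sum (fun j _ => sq_nonneg (q j)) (Finset.mem_univ i))
  have hw : (waveVecRC (c • q) : EuclideanSpace ℂ (Fin 3)) = ((c : ℝ) : ℂ) • waveVecRC q := by
    ext i; simp [waveVecRC_apply, Pi.smul_apply, smul_eq_mul]
  have hr : rdot (c • q) v = ((c : ℝ) : ℂ) * rdot q v := by
    simp only [rdot_apply, Pi.smul_apply, smul_eq_mul, Complex.ofReal_mul, Finset.mul_sum]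
    exact Finset.sum_congr rfl fun j _ => by ring
  have hs : (∑ j, (c • q) j ^ 2 : ℝ) = c ^ 2 * ∑ j, q j ^ 2 := by
    rw [Finset.mul_sum]; exact Finset.sum_congr rfl fun j _ => by rw [Pi.smul_apply, smul_eq_mul]; ring
  have hcC : ((c : ℝ) : ℂ) ≠ 0 := by exact_mod_cast hc
  have hSC : ((∑ j, q j ^ 2 : ℝ) : ℂ) ≠ 0 := by exact_mod_cast hS.ne'
  rw [transversalProjR_apply, transversalProjR_apply, hr, hw, hs, smul_smul]
  congr 1
  push_cast
  field_simp

/-- **`P^θ_{n·z} = P^θ_z`** (`n ≥ 1`). [cite: Temam1984, Ch. III §1.1] -/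
theorem transversalProjR_twistFreq_classFreq_zero (G₀ : Matrix (Fin 3) (Fin 3) ℝ) {n : ℕ} (hn : n ≠ 0) (z : Fin 3 → ℤ)
    (v : EuclideanSpace ℂ (Fin 3)) :
    transversalProjR (twistFreq G₀ (classFreq n 0 z)) v = transversalProjR (twistFreq G₀ z) v := by
  rw [twistFreq_classFreq_zero]
  exact transversalProjR_real_smul (by exact_mod_cast hn) _ v

/-! ## §2 The twisted projection of a nearby direction -/

/-- `‖waveVecRC q‖ = √|q|²`. [folklore] -/
theorem norm_waveVecRC (q : Fin 3 → ℝ) : ‖waveVecRC q‖ = Real.sqrt (nsqR q) := by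
  rw [nsqR_eq_sum, ← norm_waveVecRC_sq, Real.sqrt_sq (norm_nonneg _)]

/-- `waveVecRC q − waveVecRC q₀ = waveVecRC (q − q₀)`. [folklore] -/
theorem waveVecRC_sub (q q₀ : Fin 3 → ℝ) : waveVecRC q - waveVecRC q₀ = waveVecRC (q - q₀) := by
  ext i; simp [waveVecRC_apply]

/-- **The projection kills its own direction, hence nearly kills a nearby one**: `‖P_q (waveVecRC q₀)‖ ≤ √|q − q₀|²`. [cite: Temam1984, Ch. III §1.1] -/
theorem norm_transversalProjR_waveVecRC_le (q q₀ : Fin 3 → ℝ) :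
    ‖transversalProjR q (waveVecRC q₀)‖ ≤ Real.sqrt (nsqR (q - q₀)) := by
  have h0 : transversalProjR q (waveVecRC q) = 0 := transversalProjR_waveVecRC q
  have h1 : transversalProjR q (waveVecRC q₀) = -(transversalProjR q (waveVecRC q - waveVecRC q₀)) := by
    rw [map_sub, h0, zero_sub, neg_neg]
  rw [h1, norm_neg, waveVecRC_sub]
  calc ‖transversalProjR q (waveVecRC (q - q₀))‖ ≤ ‖waveVecRC (q - q₀)‖ := norm_transversalProjR_le _ _
    _ = Real.sqrt (nsqR (q - q₀)) := norm_waveVecRC _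

/-- `|q₀·v| ≤ √|q₀|²·‖v‖`. [folklore] -/
theorem norm_rdot_le (q₀ : Fin 3 → ℝ) (v : EuclideanSpace ℂ (Fin 3)) : ‖rdot q₀ v‖ ≤ Real.sqrt (nsqR q₀) * ‖v‖ := by
  rw [← inner_waveVecRC_left, ← norm_waveVecRC]
  exact norm_inner_le_norm _ _

/-- **The longitudinal part at `q₀` is nearly transversal at a nearby `q`**: `‖P_q (v − P_{q₀} v)‖ ≤ (√|q − q₀|²/√|q₀|²)·‖v‖` (`|q₀|² > 0`).
[cite: Temam1984, Ch. III §1.1] -/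
theorem norm_transversalProjR_sub_projR_le (q : Fin 3 → ℝ) {q₀ : Fin 3 → ℝ} (hq₀ : 0 < nsqR q₀) (v : EuclideanSpace ℂ (Fin 3)) :
    ‖transversalProjR q (v - transversalProjR q₀ v)‖ ≤ Real.sqrt (nsqR (q - q₀)) / Real.sqrt (nsqR q₀) * ‖v‖ := by
  have hsq : 0 < Real.sqrt (nsqR q₀) := Real.sqrt_pos.2 hq₀
  have hlong : v - transversalProjR q₀ v = ((((∑ j, q₀ j ^ 2 : ℝ) : ℂ))⁻¹ * rdot q₀ v) • waveVecRC q₀ := by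
    rw [transversalProjR_apply]; abel
  have hq₀' : (∑ j, q₀ j ^ 2 : ℝ) = nsqR q₀ := (nsqR_eq_sum q₀).symm
  rw [hlong, map_smul, norm_smul, norm_mul, norm_inv, Complex.norm_real, Real.norm_eq_abs, hq₀', abs_of_pos hq₀]
  have h1 := norm_transversalProjR_waveVecRC_le q q₀
  have h2 := norm_rdot_le q₀ v
  have hsqF : Real.sqrt (nsqR q₀) * Real.sqrt (nsqR q₀) = nsqR q₀ := Real.mul_self_sqrt hq₀.le
  have hinv : (nsqR q₀)⁻¹ * Real.sqrt (nsqR q₀) = (Real.sqrt (nsqR q₀))⁻¹ := by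
    nth_rw 1 [← hsqF]
    rw [mul_inv, mul_assoc, inv_mul_cancel₀ hsq.ne', mul_one]
  calc (nsqR q₀)⁻¹ * ‖rdot q₀ v‖ * ‖transversalProjR q (waveVecRC q₀)‖
      ≤ (nsqR q₀)⁻¹ * (Real.sqrt (nsqR q₀) * ‖v‖) * Real.sqrt (nsqR (q - q₀)) := by gcongr
    _ = ((nsqR q₀)⁻¹ * Real.sqrt (nsqR q₀)) * ‖v‖ * Real.sqrt (nsqR (q - q₀)) := by ring
    _ = Real.sqrt (nsqR (q - q₀)) / Real.sqrt (nsqR q₀) * ‖v‖ := by rw [hinv, div_eq_mul_inv]; ring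

/-! ## §3 The twisted viscous ξ-defect pairing bound -/

/-- **THE TWISTED VISCOUS ξ-DEFECT PAIRING BOUND**: for `|G₀ᵀz|² > 0`, `n ≥ 1`, `4|G₀ᵀℓ|² ≤ n²|G₀ᵀz|²`, ALL `r, y ∈ ℂ³`, and `K₀` any transverse bound of
`bsymb 𝔸`: `|Re⟪P^θ_{k_z} r, T_{((1/n²)•𝔸)^{G₀}}(k_z) P^θ_{k_z} y⟫ − Re⟪P^θ_z r, T_{𝔸^{G₀}}(z) P^θ_z y⟫| ≤ 534·K₀·√|G₀ᵀz|²·(√|G₀ᵀℓ|²/n)·‖y‖·‖r‖` (`k_z = ℓ + n·z`).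
[cite: Frisch1995Turbulence, §9.6.3 eq. (9.57) p. 233] [cite: ArmstrongVicol2025, §4.1 (PDF p. 34)] -/
theorem abs_re_visc_defect_le_frame {𝔸 : Torus.Visc4 (Fin 3)} {K₀ : ℝ} (hK₀ : 0 ≤ K₀)
    (hK : ∀ k p q : Fin 3 → ℝ, ∑ i, p i * k i = 0 → ∑ i, q i * k i = 0 →
      |Torus.bsymb 𝔸 k p q| ≤ K₀ * (∑ a, k a ^ 2) * (Real.sqrt (∑ i, p i ^ 2) * Real.sqrt (∑ i, q i ^ 2)))
    (G₀ : Matrix (Fin 3) (Fin 3) ℝ) {n : ℕ} (hn : n ≠ 0) (ℓ : Fin 3 → ℤ) {z : Fin 3 → ℤ} (hz : 0 < nsqR (twistFreq G₀ z))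
    (hclose : 4 * nsqR (twistFreq G₀ ℓ) ≤ (n : ℝ) ^ 2 * nsqR (twistFreq G₀ z)) (r y : EuclideanSpace ℂ (Fin 3)) :
    |(⟪transversalProjR (twistFreq G₀ (classFreq n ℓ z)) r, Torus.symbT (Torus.Visc4.conj G₀ ((1 / (n : ℝ) ^ 2) • 𝔸)) (classFreq n ℓ z)
          (transversalProjR (twistFreq G₀ (classFreq n ℓ z)) y)⟫_ℂ).re
        - (⟪transversalProjR (twistFreq G₀ z) r, Torus.symbT (Torus.Visc4.conj G₀ 𝔸) z (transversalProjR (twistFreq G₀ z) y)⟫_ℂ).re|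
      ≤ 534 * K₀ * Real.sqrt (nsqR (twistFreq G₀ z)) * (Real.sqrt (nsqR (twistFreq G₀ ℓ)) / n) * (‖y‖ * ‖r‖) := by
  have hn0 : (0 : ℝ) < n := by exact_mod_cast Nat.pos_of_ne_zero hn
  have hk₀ : 0 < nsqR (twistFreq G₀ (classFreq n 0 z)) := by
    rw [nsqR_twistFreq_classFreq_zero]; positivity
  have hsub : twistFreq G₀ (classFreq n ℓ z - classFreq n 0 z) = twistFreq G₀ ℓ := by rw [classFreq_sub_classFreq_zero]
  have hclose' : 4 * nsqR (twistFreq G₀ (classFreq n ℓ z - classFreq n 0 z)) ≤ nsqR (twistFreq G₀ (classFreq n 0 z)) := by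
    rw [hsub, nsqR_twistFreq_classFreq_zero]; exact hclose
  have hmain := SymbolLipschitz.abs_re_inner_symbT_conj_projR_sub_le hK₀ hK G₀ (classFreq n ℓ z) (classFreq n 0 z) hk₀ hclose' r y
  rw [hsub, nsqR_twistFreq_classFreq_zero, Real.sqrt_mul (sq_nonneg _), Real.sqrt_sq hn0.le] at hmain
  -- rewrite the reference term at `z` as the term at `n·z` scaled by `1/n²`
  have href : (⟪transversalProjR (twistFreq G₀ (classFreq n 0 z)) r, Torus.symbT (Torus.Visc4.conj G₀ 𝔸) (classFreq n 0 z)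
        (transversalProjR (twistFreq G₀ (classFreq n 0 z)) y)⟫_ℂ).re
      = (n : ℝ) ^ 2 * (⟪transversalProjR (twistFreq G₀ z) r, Torus.symbT (Torus.Visc4.conj G₀ 𝔸) z (transversalProjR (twistFreq G₀ z) y)⟫_ℂ).re := by
    rw [transversalProjR_twistFreq_classFreq_zero G₀ hn, transversalProjR_twistFreq_classFreq_zero G₀ hn, symbT_classFreq_zero, inner_smul_right]
    have : ((n : ℂ) ^ 2) = (((n : ℝ) ^ 2 : ℝ) : ℂ) := by push_cast; ring
    rw [this, Complex.re_ofReal_mul]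
  have hcls : (⟪transversalProjR (twistFreq G₀ (classFreq n ℓ z)) r, Torus.symbT (Torus.Visc4.conj G₀ ((1 / (n : ℝ) ^ 2) • 𝔸)) (classFreq n ℓ z)
        (transversalProjR (twistFreq G₀ (classFreq n ℓ z)) y)⟫_ℂ).re
      = (1 / (n : ℝ) ^ 2) * (⟪transversalProjR (twistFreq G₀ (classFreq n ℓ z)) r, Torus.symbT (Torus.Visc4.conj G₀ 𝔸) (classFreq n ℓ z)
        (transversalProjR (twistFreq G₀ (classFreq n ℓ z)) y)⟫_ℂ).re := by
    rw [Torus.Visc4.conj_smul, Torus.symbT_smul_tensor, inner_smul_right, Complex.re_ofReal_mul]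
  rw [hcls]
  have hn2 : (0 : ℝ) < (n : ℝ) ^ 2 := by positivity
  have key : (1 / (n : ℝ) ^ 2) * (⟪transversalProjR (twistFreq G₀ (classFreq n ℓ z)) r, Torus.symbT (Torus.Visc4.conj G₀ 𝔸) (classFreq n ℓ z)
        (transversalProjR (twistFreq G₀ (classFreq n ℓ z)) y)⟫_ℂ).re
      - (⟪transversalProjR (twistFreq G₀ z) r, Torus.symbT (Torus.Visc4.conj G₀ 𝔸) z (transversalProjR (twistFreq G₀ z) y)⟫_ℂ).re
      = (1 / (n : ℝ) ^ 2) * ((⟪transversalProjR (twistFreq G₀ (classFreq n ℓ z)) r, Torus.symbT (Torus.Visc4.conj G₀ 𝔸) (classFreq n ℓ z)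
        (transversalProjR (twistFreq G₀ (classFreq n ℓ z)) y)⟫_ℂ).re
        - (⟪transversalProjR (twistFreq G₀ (classFreq n 0 z)) r, Torus.symbT (Torus.Visc4.conj G₀ 𝔸) (classFreq n 0 z)
        (transversalProjR (twistFreq G₀ (classFreq n 0 z)) y)⟫_ℂ).re) := by
    rw [href]; field_simp
  rw [key, abs_mul, abs_of_pos (by positivity : (0:ℝ) < 1 / (n : ℝ) ^ 2)]
  calc 1 / (n : ℝ) ^ 2 * |(⟪transversalProjR (twistFreq G₀ (classFreq n ℓ z)) r, Torus.symbT (Torus.Visc4.conj G₀ 𝔸) (classFreq n ℓ z)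
        (transversalProjR (twistFreq G₀ (classFreq n ℓ z)) y)⟫_ℂ).re
        - (⟪transversalProjR (twistFreq G₀ (classFreq n 0 z)) r, Torus.symbT (Torus.Visc4.conj G₀ 𝔸) (classFreq n 0 z)
        (transversalProjR (twistFreq G₀ (classFreq n 0 z)) y)⟫_ℂ).re|
      ≤ 1 / (n : ℝ) ^ 2 * (534 * K₀ * ((n : ℝ) * Real.sqrt (nsqR (twistFreq G₀ z))) * Real.sqrt (nsqR (twistFreq G₀ ℓ)) * (‖y‖ * ‖r‖)) :=
        mul_le_mul_of_nonneg_left hmain (by positivity)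
    _ = 534 * K₀ * Real.sqrt (nsqR (twistFreq G₀ z)) * (Real.sqrt (nsqR (twistFreq G₀ ℓ)) / n) * (‖y‖ * ‖r‖) := by
        field_simp

end Summit.AnomalousDissipation.AnomalousDissipation.Theorems.SolenoidalFractalHomogenisation.LagrangianStep.Sideband

end
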